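import Mathlib
import HarnessLib

/-!
# Forster's Theorem 4.1, part IIa: spectral expansion of `AᵀA`

Route `route-QuantumAdvantage-HankelLift`; infrastructure toward discharging the named fact
`Literature.Computability.Complexity.ForsterIsotropicPosition` (Forster 2002, Thm 4.1).

This file: the spectral expansion of `AᵀA` in plain coordinates (`spectral_data`: reals `λ_j ≥ 0`
and an orthonormal basis `e_j` with `‖Au‖² = ∑_j λ_j ⟨e_j,u⟩²`, `‖u‖² = ∑_j ⟨e_j,u⟩²`,
`∑λ_j = ∑A_{ij}²`, `∏λ_j = det(A)²`), from `Matrix.IsHermitian.spectral_theorem` through the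
orthogonal matrix `eigenvectorUnitary`.  Consumer: `…ForsterCoercive.lean` (coercivity of
`Φ(A) = ∑_x log ‖A u_x‖² − (|X|/k)·log (det A)²` on the unit Frobenius sphere).
[cite: Forster2002, Theorem 4.1]
-/

set_option linter.dupNamespace false -- D-0017: single-problem summit ⇒ `QuantumAdvantage.QuantumAdvantage` by design

noncomputable section

namespace Summit.QuantumAdvantage.QuantumAdvantage.Theorems.HankelLift.Forster

open Finset Real Matrix

/-! ## Spectral expansion of `AᵀA` -/

/-- **Spectral data of `AᵀA`** (real spectral theorem, `Matrix.IsHermitian.spectral_theorem`): there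
are reals `λ_j ≥ 0` and an orthonormal basis `e_j` of `ℝ^k` with `‖Au‖² = ∑_j λ_j ⟨e_j, u⟩²`,
`‖u‖² = ∑_j ⟨e_j,u⟩²`, `∑_j λ_j = ∑_{ij} A_{ij}²` and `∏_j λ_j = (det A)²`. [folklore] -/
theorem spectral_data {k : ℕ} (A : Matrix (Fin k) (Fin k) ℝ) :
    ∃ (lam : Fin k → ℝ) (e : Fin k → Fin k → ℝ),
      (∀ i j, e i ⬝ᵥ e j = if i = j then 1 else 0) ∧
      (∀ u : Fin k → ℝ, (A *ᵥ u) ⬝ᵥ (A *ᵥ u) = ∑ j, lam j * (e j ⬝ᵥ u) ^ 2) ∧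
      (∀ u : Fin k → ℝ, u ⬝ᵥ u = ∑ j, (e j ⬝ᵥ u) ^ 2) ∧
      (∑ j, lam j = ∑ i, ∑ j, A i j ^ 2) ∧
      (∏ j, lam j = A.det ^ 2) ∧
      (∀ j, 0 ≤ lam j) := by
  classical
  set B : Matrix (Fin k) (Fin k) ℝ := Aᵀ * A with hBdef
  have hB : B.IsHermitian := by
    have h := Matrix.isHermitian_conjTranspose_mul_self A
    rwa [Matrix.conjTranspose_eq_transpose_of_trivial] at h
  set U : Matrix (Fin k) (Fin k) ℝ := (hB.eigenvectorUnitary : Matrix (Fin k) (Fin k) ℝ) with hUdef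
  set lam : Fin k → ℝ := hB.eigenvalues with hlam
  have hstar : star U = Uᵀ := by
    rw [Matrix.star_eq_conjTranspose, Matrix.conjTranspose_eq_transpose_of_trivial]
  have hUtU : Uᵀ * U = 1 := by
    have h := Unitary.coe_star_mul_self hB.eigenvectorUnitary
    rwa [hstar] at h
  have hUUt : U * Uᵀ = 1 := by
    have h := Unitary.coe_mul_star_self hB.eigenvectorUnitary
    rwa [Unitary.coe_star, hstar] at h
  have hspec : B = U * Matrix.diagonal lam * Uᵀ := by
    have h := hB.spectral_theorem
    rw [Unitary.conjStarAlgAut_apply, hstar] at h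
    rw [h]
    congr 2
  have hc : ∀ (v : Fin k → ℝ) (j : Fin k), (Uᵀ *ᵥ v) j = Uᵀ j ⬝ᵥ v := fun v j => rfl
  have hquad : ∀ v : Fin k → ℝ, (A *ᵥ v) ⬝ᵥ (A *ᵥ v) = ∑ j, lam j * (Uᵀ j ⬝ᵥ v) ^ 2 := by
    intro v
    have h1 : (A *ᵥ v) ⬝ᵥ (A *ᵥ v) = v ⬝ᵥ (B *ᵥ v) := by
      rw [hBdef, ← Matrix.mulVec_mulVec, Matrix.dotProduct_mulVec v Aᵀ (A *ᵥ v),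
        Matrix.vecMul_transpose]
    rw [h1, hspec, ← Matrix.mulVec_mulVec, ← Matrix.mulVec_mulVec, Matrix.dotProduct_mulVec v U,
      ← Matrix.mulVec_transpose, dotProduct]
    refine Finset.sum_congr rfl fun j _ => ?_
    rw [Matrix.mulVec_diagonal, hc, sq]
    ring
  refine ⟨lam, fun j => Uᵀ j, fun i j => ?_, hquad, fun u => ?_, ?_, ?_, ?_⟩
  · -- orthonormality
    have h := congrFun (congrFun hUtU i) j
    rw [Matrix.mul_apply, Matrix.one_apply] at h
    rw [← h]
    rfl
  · -- Parseval
    have h0 : u ⬝ᵥ u = u ⬝ᵥ ((U * Uᵀ) *ᵥ u) := by rw [hUUt, Matrix.one_mulVec]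
    rw [h0, ← Matrix.mulVec_mulVec, Matrix.dotProduct_mulVec u U, ← Matrix.mulVec_transpose,
      dotProduct]
    refine Finset.sum_congr rfl fun j _ => ?_
    rw [hc, sq]
  · -- trace
    have h := hB.trace_eq_sum_eigenvalues
    simp only [RCLike.ofReal_real_eq_id, id_eq] at h
    rw [← hlam] at h
    rw [← h, hBdef, Matrix.trace]
    simp only [Matrix.diag_apply, Matrix.mul_apply, Matrix.transpose_apply]
    rw [Finset.sum_comm]
    exact Finset.sum_congr rfl fun i _ => Finset.sum_congr rfl fun j _ => by ring
  · -- determinant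
    have h := hB.det_eq_prod_eigenvalues
    simp only [RCLike.ofReal_real_eq_id, id_eq] at h
    rw [← hlam] at h
    rw [← h, hBdef, Matrix.det_mul, Matrix.det_transpose, sq]
  · -- nonnegativity: `λ_j = ‖A e_j‖²`
    intro j
    have horth : ∀ i, Uᵀ i ⬝ᵥ Uᵀ j = if i = j then 1 else 0 := by
      intro i
      have h := congrFun (congrFun hUtU i) j
      rw [Matrix.mul_apply, Matrix.one_apply] at h
      rw [← h]; rfl
    have hexp : (A *ᵥ Uᵀ j) ⬝ᵥ (A *ᵥ Uᵀ j) = ∑ i, lam i * (Uᵀ i ⬝ᵥ Uᵀ j) ^ 2 := hquad (Uᵀ j)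
    have hsum : ∑ i, lam i * (Uᵀ i ⬝ᵥ Uᵀ j) ^ 2 = lam j := by
      rw [Finset.sum_eq_single j]
      · rw [horth j, if_pos rfl]; ring
      · intro i _ hij; rw [horth i, if_neg hij]; ring
      · intro h; exact absurd (Finset.mem_univ j) h
    rw [← hsum, ← hexp]
    exact Finset.sum_nonneg fun l _ => mul_self_nonneg _

end Summit.QuantumAdvantage.QuantumAdvantage.Theorems.HankelLift.Forster
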